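import Mathlib.Tactic
import HarnessLib
import HarnessLib.Audit.Tags
import Summits.CriticalPhenomena.PercolationContinuityZ3.Theorems.PercNearOneGluingNoHeavyLowerTailSahiAntichainSplitFive

/-!
# Antichains, meets plus joins: the cross-rectangle conjecture (XY) and its reduction to V5

Support file (seat `prim-masterthm-p1`, gen 36; `--supports stmt-CriticalPhenomena-4575`).  No `sorry`, standard axioms; one typed
conjecture (a `def … : Prop`).  Memo `run/shared/lean/prim/prim-masterthm/FROM-prim-masterthm-p1-g36-DUALITY-PROJECTION-SUNFLOWER.md`
(headline (E), §4).

SETTING (files `…SahiAntichainSplit*`): at a point `r`, `above P r` / `below P r` are the members containing / avoiding `r`,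
`crossMeets P r = {a ∩ b}`, `crossJoins P r = {a ∪ b}` (`a` above, `b` below), `newLabels P r` the number of cross labels that are
new.  V5: an antichain has `2 #P ≤ #meets P + #joins P + 2`.  Gen 35 reduced V5 to the dichotomy `AntichainGoodPointOrRich`.

NEW HERE ([this work], gen 36).
* `card_meets_above_add_card_crossMeets_le` / `card_joins_below_add_card_crossJoins_le`: the meets inside `above` and the cross meets
  are disjoint subfamilies of `meets P` (the former contain `r`, the latter avoid it); dually for joins.  Hence (`two_mul_card_lt_of_crossRect`)
  at any point with two members on each side, `#crossMeets + #crossJoins ≥ 2 #P − 3` already forces `2 #P ≤ #meets + #joins + 1` —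
  V5 with one to spare, WITHOUT any hypothesis on the two halves.
* **CONJECTURE (XY)** `AntichainCrossRect` (typed): at a point with `newLabels ≤ 1` and at least three members on each side,
  `2 #P ≤ #crossMeets P r + #crossJoins P r + 3`.  EVIDENCE (memo (E)): all 480 such instances on `2^6` (slack 0 or 1); all 274 385
  bad-point records (47 376 families, n ≤ 10) of kit census j282885 (slack ≥ 0, = 0 only on one N = 17 six-point type); a targeted
  annealer (15 344 further instances, n = 7, 8): no failure.  Daykin's inequality gives only `#crossMeets · #crossJoins ≥ #above · #below`;
  (XY) asks for twice the AM–GM value under the absorption hypotheses.  With `newLabels = 2` the analogous bound FAILS (`C([6],3)`,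
  `C([8],4)`), so (XY) sits exactly at the boundary.
* **(XY) ⟹ V5** (`two_mul_card_le_of_crossRect`), by strong induction on `#P`: at an effective point either `newLabels ≥ 2` (split step
  `two_mul_card_le_step` with the induction hypothesis on both sides), or a side has at most two members (then `newLabels ≥ 2` by
  `two_le_newLabels_of_min_le_two`), or (XY) applies.  So (XY) joins `AntichainGoodPointOrRich` as a sufficient condition for V5; unlike
  the latter it is a statement about the cross rectangle of ONE point only.
HONEST FRAMING: (XY) and V5 remain OPEN. [this work]
-/

namespace Summit.CriticalPhenomena.PercolationContinuityZ3.Theorems.SahiColouredDaykin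

open Finset

variable {α : Type*} [DecidableEq α]

/-! ### 1. The cross rectangle sits inside `meets P`, `joins P` next to one half -/

/-- `meets (above P r)` and `crossMeets P r` are disjoint parts of `meets P`. [this work] -/
theorem card_meets_above_add_card_crossMeets_le (P : Finset (Finset α)) (r : α) :
    #(meets (above P r)) + #(crossMeets P r) ≤ #(meets P) := by
  have hdisj : Disjoint (meets (above P r)) (crossMeets P r) := by
    rw [disjoint_left]
    intro Z h1 h2
    exact not_mem_of_mem_meets_below_union (mem_union_right _ h2) (mem_of_mem_meets_above h1)
  rw [← card_union_of_disjoint hdisj]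
  apply card_le_card
  rw [meets_eq_union P r]
  exact union_subset_union (subset_refl _) subset_union_right

/-- `joins (below P r)` and `crossJoins P r` are disjoint parts of `joins P`. [this work] -/
theorem card_joins_below_add_card_crossJoins_le (P : Finset (Finset α)) (r : α) :
    #(joins (below P r)) + #(crossJoins P r) ≤ #(joins P) := by
  have hdisj : Disjoint (joins (below P r)) (crossJoins P r) := by
    rw [disjoint_left]
    intro W h1 h2
    exact not_mem_of_mem_joins_below h1 (mem_of_mem_joins_above_union (mem_union_right _ h2))
  rw [← card_union_of_disjoint hdisj]
  apply card_le_card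
  rw [joins_eq_union P r]
  exact union_subset_union (subset_refl _) subset_union_right

/-- Two distinct members have a meet: `#meets Q ≥ 1` when `#Q ≥ 2`. [this work] -/
theorem one_le_card_meets_of_two_le {Q : Finset (Finset α)} (h : 2 ≤ #Q) : 1 ≤ #(meets Q) := by
  obtain ⟨a, b, ha, hb, hab⟩ := one_lt_card_iff.1 (by omega : 1 < #Q)
  exact card_pos.2 ⟨a ∩ b, mem_meets_iff.2 ⟨a, ha, b, hb, hab, rfl⟩⟩

/-- Two distinct members have a join: `#joins Q ≥ 1` when `#Q ≥ 2`. [this work] -/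
theorem one_le_card_joins_of_two_le {Q : Finset (Finset α)} (h : 2 ≤ #Q) : 1 ≤ #(joins Q) := by
  obtain ⟨a, b, ha, hb, hab⟩ := one_lt_card_iff.1 (by omega : 1 < #Q)
  exact card_pos.2 ⟨a ∪ b, mem_joins_iff.2 ⟨a, ha, b, hb, hab, rfl⟩⟩

/-- **A rich cross rectangle gives V5 with one to spare**, with no hypothesis on the halves: if both sides have at least two members and
`#crossMeets + #crossJoins ≥ 2 #P − 3`, then `2 #P ≤ #meets P + #joins P + 1`. [this work] -/
theorem two_mul_card_lt_of_crossRect (P : Finset (Finset α)) (r : α) (hA : 2 ≤ #(above P r)) (hB : 2 ≤ #(below P r))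
    (hXY : 2 * #P ≤ #(crossMeets P r) + #(crossJoins P r) + 3) : 2 * #P ≤ #(meets P) + #(joins P) + 1 := by
  have h1 := card_meets_above_add_card_crossMeets_le P r
  have h2 := card_joins_below_add_card_crossJoins_le P r
  have h3 := one_le_card_meets_of_two_le hA
  have h4 := one_le_card_joins_of_two_le hB
  omega

/-! ### 2. The conjecture and the reduction -/

/-- **CONJECTURE (XY) (cross rectangle; typed).**  At a point `r` of an antichain with `newLabels P r ≤ 1` and at least three members
on each side, the cross meets and cross joins number at least `2 #P − 3`: `2 #P ≤ #crossMeets P r + #crossJoins P r + 3`.  Evidence and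
boundary cases: file header.  [this work] [status: open] -/
@[conjecture] def AntichainCrossRect (α : Type*) [DecidableEq α] : Prop :=
  ∀ P : Finset (Finset α), IsAntichain (· ⊆ ·) (P : Set (Finset α)) → ∀ r : α,
    newLabels P r ≤ 1 → 3 ≤ #(above P r) → 3 ≤ #(below P r) →
      2 * #P ≤ #(crossMeets P r) + #(crossJoins P r) + 3

/-- **(XY) implies V5**, by strong induction on `#P`: split at a good point, or the small-side steps, or the rectangle. [this work] -/
theorem two_mul_card_le_of_crossRect (h : AntichainCrossRect α) :
    ∀ P : Finset (Finset α), IsAntichain (· ⊆ ·) (P : Set (Finset α)) → 2 * #P ≤ #(meets P) + #(joins P) + 2 := by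
  suffices H : ∀ n, ∀ P : Finset (Finset α), #P = n → IsAntichain (· ⊆ ·) (P : Set (Finset α)) →
      2 * #P ≤ #(meets P) + #(joins P) + 2 from fun P hP => H _ P rfl hP
  intro n
  induction n using Nat.strong_induction_on with
  | _ n ih =>
    intro P hPn hanti
    by_cases h2 : 2 ≤ #P
    · obtain ⟨r, hr⟩ := effPoints_nonempty h2
      obtain ⟨hA, hB⟩ := mem_effPoints_iff.1 hr
      have hcard := card_above_add_card_below P r
      have hApos : 0 < #(above P r) := card_pos.2 hA
      have hBpos : 0 < #(below P r) := card_pos.2 hB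
      by_cases hgood : 2 ≤ newLabels P r
      · have ihA := ih (#(above P r)) (by omega) (above P r) rfl (isAntichain_above hanti r)
        have ihB := ih (#(below P r)) (by omega) (below P r) rfl (isAntichain_below hanti r)
        exact two_mul_card_le_step P r hgood ihA ihB
      · -- a bad point: both sides have at least three members, and the rectangle conjecture applies
        have h3A : 3 ≤ #(above P r) := by
          by_contra hlt
          exact hgood (two_le_newLabels_of_min_le_two hanti hA hB (Or.inl (by omega)))
        have h3B : 3 ≤ #(below P r) := by
          by_contra hlt
          exact hgood (two_le_newLabels_of_min_le_two hanti hA hB (Or.inr (by omega)))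
        have hXY := h P hanti r (by omega) h3A h3B
        have := two_mul_card_lt_of_crossRect P r (by omega) (by omega) hXY
        omega
    · omega

/-- **(XY) implies the good-point-or-rich step in its V5 form at every bad point**: under (XY), a point with `newLabels ≤ 1` and both
sides nonempty already yields `2 #P ≤ #meets + #joins + 1`. [this work] -/
theorem two_mul_card_lt_of_crossRect_bad (h : AntichainCrossRect α) {P : Finset (Finset α)} {r : α}
    (hanti : IsAntichain (· ⊆ ·) (P : Set (Finset α))) (hA : (above P r).Nonempty) (hB : (below P r).Nonempty)
    (hbad : newLabels P r ≤ 1) : 2 * #P ≤ #(meets P) + #(joins P) + 1 := by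
  have h3A : 3 ≤ #(above P r) := by
    by_contra hlt
    have := two_le_newLabels_of_min_le_two hanti hA hB (Or.inl (by omega)); omega
  have h3B : 3 ≤ #(below P r) := by
    by_contra hlt
    have := two_le_newLabels_of_min_le_two hanti hA hB (Or.inr (by omega)); omega
  exact two_mul_card_lt_of_crossRect P r (by omega) (by omega) (h P hanti r hbad h3A h3B)

end Summit.CriticalPhenomena.PercolationContinuityZ3.Theorems.SahiColouredDaykin
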